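import Summits.BirchSwinnertonDyer.Rank1Residual.ManinAdditive.ConwayKodairaLaws
import Summits.BirchSwinnertonDyer.BirchSwinnertonDyer.Theorems.ManinLocalTwoThreeTamagawaTwoAtFourHolds
import Summits.BirchSwinnertonDyer.BirchSwinnertonDyer.Theorems.ManinLocalTwoThreeEvenManinKummerSquare
import Summits.BirchSwinnertonDyer.BirchSwinnertonDyer.Theorems.ManinLocalTwoThreeDepthTransfer
import Literature.NumberTheory.EllipticCurves.PadicFiltrationIndexProofs
import Literature.NumberTheory.EllipticCurves.CanonicalPAdicHeightThetaProofs
import Literature.NumberTheory.EllipticCurves.ManinConstantAdditivePrimesProofs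
import Literature.NumberTheory.EllipticCurves.TamagawaSubgroupProofs
import Mathlib.RingTheory.Polynomial.RationalRoot
import HarnessLib

/-!
# desc's Tate hypothesis (T2) of `tameConwayKodairaLaw_of_laws` DISCHARGED: at `4 ∥ N` every rational `2`-torsion point lies in
# the identity component `E⁰(ℚ₂)` (route `ManinLocalTwoThree`, cell bsd-f2-manin, crux C2 `ManinOddAtFour` stmt-BirchSwinnertonDyer-22967;
# prover seat p3 gen 13, E-blind helper)

`Summits/…/ManinAdditive/ConwayKodairaLaws.lean` (desc g6, refuter-1 `RefAudit65`) reduces the tame Conway–Kodaira law E-desc-38 to the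
laws E-desc-40/41/31 MODULO two Tate facts: (T1) `4 ∥ N ⟹ v₂(Δ_min) ∈ {4, 8}` (discharged there) and
(T2) «a tame IV* curve with rational 2-torsion has a rational 2-torsion point in `E⁰(ℚ₂)`», kept as the hypothesis
`T2 : ∀ W [IsElliptic] [IsGloballyMinimal], IsTypeFourStarAtTwoTame W → HasRationalTwoTorsion W → HasTwoTorsionInIdentityComponentAtTwo W`
of `tameConwayKodairaLaw_of_laws`.  THIS FILE PROVES (T2) — in fact the stronger

* `hasTwoTorsionInIdentityComponentAtTwo_of_odd_tamagawaAt` — `W` globally minimal and ADDITIVE at `2`, `c₂(W)` ODD, `E(ℚ)[2] ≠ 0 ⟹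
  HasTwoTorsionInIdentityComponentAtTwo W` (desc's elementary predicate: an INTEGRAL point `(x, y)` with `2y + a₁x + a₃ = 0` whose
  partial derivatives are not both even);
* `hasTwoTorsionInIdentityComponentAtTwo_of_padicValNat_conductorNorm_eq_two` — the case `4 ∥ N` (`c₂ ∈ {1, 3}`, this seat's
  `tamagawaTwoMemOneThreeAtFour_holds`, p707853), covering BOTH tame types IV and IV*;
* `tateTwoTorsionIdentityComponent_T2` — (T2) verbatim, and `tameConwayKodairaLaw_of_laws'` — desc's reduction with (T2) discharged:
  **`UnstarredConwayFullLaw → StarredConwayDefectLaw → ConwayFullOfIdentityComponentTorsion → TameConwayKodairaLaw`**;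
* `not_two_dvd_maninConstant_of_hasRationalTwoTorsion_tame` — desc's chain `not_two_dvd_maninConstant_of_identityComponentTorsion'`
  (E-desc-31 law + GIVEN row E-desc-28♯ ⟹ `2 ∤ c`) now fed by plain RATIONAL `2`-TORSION at `4 ∥ N`.

PROOF.  (1) additivity at `2` makes `a₁, a₃` even on the minimal model (`even_a₁_and_even_a₃_of_hasAdditiveReductionAt_two`, Kraus parities;
tree file `…EvenManinKummerSquare`), so the `2`-division
cubic `4x³ + b₂x² + 2b₄x + b₆` is `4·`(monic integral cubic) and a rational root `x` is an INTEGER (integral root theorem,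
Mathlib `isInteger_of_is_root_of_monic`); `y := −(a₁x + a₃)/2 ∈ ℤ` and `T = (x, y)` is a rational point with `2T = O`.
(2) In `E(ℚ₂)` (Mathlib `ℚ_[2]`, the global minimal model is `ℤ₂`-minimal, `isMinimal_map_padic_of_isGloballyMinimal`) the subgroup
`E⁰(ℚ₂)` of points with nonsingular reduction has index `c₂` (`localTamagawaNumber_eq_index_of_isMinimal`), so `c₂ • T ∈ E⁰(ℚ₂)`
(Lagrange in `E/E⁰`, Mathlib `AddSubgroup.nsmul_index_mem`) and `c₂` odd, `2T = O` give `T ∈ E⁰(ℚ₂)`.  (3) `E⁰(ℚ₂)` IS the set of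
points with nonsingular reduction (Silverman *AEC* VII.2.1, tree `mem_goodReductionSubgroup_iff_holds` /
`goodReductionSubgroup_baseChange_eq`), and for the integral point `T` nonsingularity of `(x̄, ȳ)` on `W mod 2` reads
`∂F/∂x = a₁y − 3x² − 2a₂x − a₄` odd or `∂F/∂y = 2y + a₁x + a₃ (= 0)` odd — desc's predicate.

HONEST FRAMING.  An E-blind local fact (Tate's algorithm folklore) now a tree theorem; it removes the hypothesis (T2) from desc's
law reduction.  Nothing about C2, Manin's conjecture or BSD is proved; C2 stays OPEN.  No definitions, no sorry, axioms standard.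

[cite: SilvermanAEC2009, VII.2 Prop. 2.1 (E₀ = points with nonsingular reduction), VII.6 (c = [E(K) : E₀(K)]), VIII.8 (global minimal models)]
[cite: SilvermanATAEC1994, IV.9.4 Steps 3–5 and Table 4.1 (c ∈ {1, 3} for types IV, IV*)]
-/

set_option autoImplicit false
-- lint-debt: the directory name repeats the summit name (sibling precedent `ManinLocalTwoThreeTamagawaTwoAtFourHolds.lean`)
set_option linter.dupNamespace false

noncomputable section

open scoped NumberField Classical
open IsDedekindDomain Rat.HeightOneSpectrum Polynomial
open WeierstrassCurve Literature.NumberTheory.EllipticCurves Literature.NumberTheory.EllipticCurves.ModularForms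
open Summit.BirchSwinnertonDyer.Rank1Residual.ManinAdditive
open Summit.BirchSwinnertonDyer.Rank1Residual.ManinAdditive.ConwayCut
open Summit.BirchSwinnertonDyer.Rank1Residual.ManinAdditive.ThetaBrandt

namespace Summit.BirchSwinnertonDyer.BirchSwinnertonDyer.Theorems.ManinLocalTwoThree

/-! ## §1 A rational root of the `2`-division cubic is an integral `2`-torsion point when `a₁, a₃` are even -/

/-- **Integral `2`-torsion from a rational `2`-division root, `a₁ = 2a`, `a₃ = 2b`.**  If `M` is an integral Weierstrass equation with
`a₁, a₃` even and `x ∈ ℚ` is a root of the `2`-division cubic `4x³ + b₂x² + 2b₄x + b₆` of `M_ℚ`, then `x ∈ ℤ` (it is a root of the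
MONIC integral cubic `X³ + (a² + a₂)X² + (a₄ + 2ab)X + (b² + a₆)`), and with `y := −(ax + b)`: `(x, y) ∈ M(ℤ)`, `2y + a₁x + a₃ = 0`.
[cite: SilvermanAEC2009, III.2.3 (the 2-division polynomial) and VIII.7 (integral root theorem, folklore)] -/
theorem exists_int_twoTorsionPoint_of_even (M : WeierstrassCurve ℤ) {a b : ℤ} (ha : M.a₁ = a + a) (hb : M.a₃ = b + b)
    {x : ℚ} (hx : (M.map (Int.castRingHom ℚ)).twoTorsionPolynomial.toPoly.eval x = 0) :
    ∃ x₀ : ℤ, (x₀ : ℚ) = x ∧ M.toAffine.Equation x₀ (-(a * x₀ + b)) ∧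
      2 * (-(a * x₀ + b)) + M.a₁ * x₀ + M.a₃ = 0 := by
  simp only [WeierstrassCurve.twoTorsionPolynomial, Cubic.toPoly, Polynomial.eval_add, Polynomial.eval_mul,
    Polynomial.eval_C, Polynomial.eval_pow, Polynomial.eval_X, WeierstrassCurve.b₂, WeierstrassCurve.b₄,
    WeierstrassCurve.b₆, map_a₁, map_a₂, map_a₃, map_a₄, map_a₆, eq_intCast, ha, hb] at hx
  push_cast at hx
  -- the monic integral cubic
  set p : ℤ[X] := Cubic.toPoly ⟨1, a ^ 2 + M.a₂, M.a₄ + 2 * a * b, b ^ 2 + M.a₆⟩ with hp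
  have hmonic : p.Monic := Cubic.monic_of_a_eq_one rfl
  have haeval : aeval x p = 0 := by
    simp only [hp, Cubic.toPoly, map_add, map_mul, map_pow, aeval_X, eq_intCast, map_intCast, map_one, map_ofNat,
      one_mul]
    linear_combination (1 / 4 : ℚ) * hx
  obtain ⟨x₀, hx₀, -⟩ := exists_integer_of_is_root_of_monic hmonic haeval
  rw [algebraMap_int_eq, eq_intCast] at hx₀
  refine ⟨x₀, hx₀.symm, ?_, by rw [ha, hb]; ring⟩
  rw [WeierstrassCurve.Affine.equation_iff]
  -- the integer identity is the rational one divided by `4`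
  have hxQ : ((x₀ : ℚ)) ^ 3 + ((a : ℚ) ^ 2 + M.a₂) * (x₀ : ℚ) ^ 2 + ((M.a₄ : ℚ) + 2 * a * b) * x₀ + ((b : ℚ) ^ 2 + M.a₆) = 0 := by
    rw [← hx₀]; linear_combination (1 / 4 : ℚ) * hx
  have hxZ : x₀ ^ 3 + (a ^ 2 + M.a₂) * x₀ ^ 2 + (M.a₄ + 2 * a * b) * x₀ + (b ^ 2 + M.a₆) = 0 := by exact_mod_cast hxQ
  change (-(a * x₀ + b)) ^ 2 + M.a₁ * x₀ * (-(a * x₀ + b)) + M.a₃ * (-(a * x₀ + b)) = x₀ ^ 3 + M.a₂ * x₀ ^ 2 + M.a₄ * x₀ + M.a₆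
  rw [ha, hb]; linear_combination -hxZ

/-! ## §2 `c₂` odd ⟹ the rational `2`-torsion lies in `E⁰(ℚ₂)` ⟹ desc's parity predicate -/

/-- `(2 : ℤ₂)` reduces to `0` in the residue field `𝔽₂` of `ℤ₂`. [folklore] -/
private theorem residue_two_eq_zero :
    IsLocalRing.residue ℤ_[2] 2 = 0 := by
  rw [IsLocalRing.residue_eq_zero_iff, PadicInt.maximalIdeal_eq_span_p, Ideal.mem_span_singleton]
  exact ⟨1, by simp⟩

/-- **additive at `2`, `c₂` odd, `E(ℚ)[2] ≠ 0 ⟹` a rational `2`-torsion point lies in `E⁰(ℚ₂)`** (desc's elementary predicate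
`HasTwoTorsionInIdentityComponentAtTwo`: an integral `(x, y)` with `2y + a₁x + a₃ = 0` and `(∂F/∂x, ∂F/∂y) ≢ (0, 0) (mod 2)`).
Silverman *AEC* VII.2.1 (`E⁰(ℚ₂)` = points of the minimal model with nonsingular reduction, a subgroup of index `c₂`), Lagrange
in `E(ℚ₂)/E⁰(ℚ₂)`, and §1. [cite: SilvermanAEC2009, VII.2 Prop. 2.1 and VII.6 (c = [E(K) : E₀(K)])] -/
theorem hasTwoTorsionInIdentityComponentAtTwo_of_odd_tamagawaAt (W : WeierstrassCurve ℚ) [W.IsElliptic] [W.IsGloballyMinimal]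
    (hadd : W.HasAdditiveReductionAt ((primesEquiv (R := 𝓞 ℚ)).symm ⟨2, Nat.prime_two⟩)) (hodd : Odd (tamagawaAt W 2))
    (hT : HasRationalTwoTorsion W) :
    HasTwoTorsionInIdentityComponentAtTwo W := by
  set M : WeierstrassCurve ℤ := integralModelInt W with hM
  have hWM : M.map (Int.castRingHom ℚ) = W := map_integralModelInt W
  have ha₁ : W.a₁ = (M.a₁ : ℚ) := by rw [← hWM, map_a₁, eq_intCast]
  have ha₂ : W.a₂ = (M.a₂ : ℚ) := by rw [← hWM, map_a₂, eq_intCast]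
  have ha₃ : W.a₃ = (M.a₃ : ℚ) := by rw [← hWM, map_a₃, eq_intCast]
  have ha₄ : W.a₄ = (M.a₄ : ℚ) := by rw [← hWM, map_a₄, eq_intCast]
  have ha₆ : W.a₆ = (M.a₆ : ℚ) := by rw [← hWM, map_a₆, eq_intCast]
  -- §1: an INTEGRAL rational 2-torsion point `T = (x₀, y₀)`
  obtain ⟨⟨a, ha⟩, ⟨b, hb⟩⟩ := even_a₁_and_even_a₃_of_hasAdditiveReductionAt_two W hadd
  obtain ⟨x, hx⟩ := hT
  rw [← hWM] at hx
  obtain ⟨x₀, -, hEZ, h2yZ⟩ := exists_int_twoTorsionPoint_of_even M ha hb hx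
  set y₀ : ℤ := -(a * x₀ + b) with hy₀
  have hE : W.toAffine.Equation (x₀ : ℚ) (y₀ : ℚ) := by
    rw [WeierstrassCurve.Affine.equation_iff] at hEZ ⊢
    rw [ha₁, ha₂, ha₃, ha₄, ha₆]
    exact_mod_cast hEZ
  have hns : W.toAffine.Nonsingular (x₀ : ℚ) (y₀ : ℚ) := (Affine.equation_iff_nonsingular (W := W.toAffine)).mp hE
  -- §2: the local model at `2`
  set W₀ : WeierstrassCurve ℤ_[2] := M.map (Int.castRingHom ℤ_[2]) with hW₀
  have hWeq : W.baseChange ℚ_[2] = W₀.baseChange ℚ_[2] := by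
    rw [← hWM]
    simp only [hW₀, WeierstrassCurve.baseChange, WeierstrassCurve.map_map]
    exact congrArg M.map (Subsingleton.elim _ _)
  haveI hmin : (W₀.baseChange ℚ_[2]).IsMinimal ℤ_[2] := hWeq ▸ isMinimal_map_padic_of_isGloballyMinimal W 2
  haveI hell : (W₀.baseChange ℚ_[2]).IsElliptic := by
    rw [← hWeq, WeierstrassCurve.baseChange]; infer_instance
  have e₁ : (W₀.baseChange ℚ_[2]).a₁ = (M.a₁ : ℚ_[2]) := by
    simp only [hW₀, WeierstrassCurve.baseChange, WeierstrassCurve.map_map, WeierstrassCurve.map_a₁, eq_intCast]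
  have e₃ : (W₀.baseChange ℚ_[2]).a₃ = (M.a₃ : ℚ_[2]) := by
    simp only [hW₀, WeierstrassCurve.baseChange, WeierstrassCurve.map_map, WeierstrassCurve.map_a₃, eq_intCast]
  -- the `ℚ₂`-point `P = T ⊗ ℚ₂` and `2 • P = 0`
  have hnsP : (W₀.baseChange ℚ_[2]).toAffine.Nonsingular ((x₀ : ℚ) : ℚ_[2]) ((y₀ : ℚ) : ℚ_[2]) :=
    hWeq ▸ WeierstrassCurve.nonsingular_ratCast (p := 2) hns
  set P : (W₀.baseChange ℚ_[2]).toAffine.Point := .some _ _ hnsP with hP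
  have h2P : P + P = 0 := by
    refine Affine.Point.add_self_of_Y_eq ?_
    change ((y₀ : ℚ) : ℚ_[2]) = -((y₀ : ℚ) : ℚ_[2]) - (W₀.baseChange ℚ_[2]).a₁ * ((x₀ : ℚ) : ℚ_[2]) - (W₀.baseChange ℚ_[2]).a₃
    rw [e₁, e₃]
    have h := congrArg (fun n : ℤ => (n : ℚ_[2])) h2yZ
    push_cast at h ⊢
    linear_combination h
  -- `P ∈ E⁰(ℚ₂)`: the index `c₂` is odd (Lagrange in `E/E⁰`)
  set H : AddSubgroup (W₀.baseChange ℚ_[2]).toAffine.Point := (W₀.baseChange ℚ_[2]).goodReductionSubgroup ℤ_[2] with hH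
  have hidx : H.index = tamagawaAt W 2 := by
    rw [hH, ← WeierstrassCurve.localTamagawaNumber_eq_index_of_isMinimal, ← hWeq]
    unfold tamagawaAt
    rw [dif_pos Nat.prime_two]
  have hPH : P ∈ H := by
    have h := AddSubgroup.nsmul_index_mem H P
    obtain ⟨m, hm⟩ := hodd
    rw [hidx, hm, add_nsmul, one_nsmul, mul_nsmul, two_nsmul, h2P, nsmul_zero, zero_add] at h
    exact h
  -- `E⁰(ℚ₂)` is the set of points with nonsingular reduction
  rw [hH, WeierstrassCurve.goodReductionSubgroup_baseChange_eq ℤ_[2] W₀, WeierstrassCurve.mem_nonsingularReductionSubgroup_iff] at hPH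
  change ((x₀ : ℚ) : ℚ_[2]) ∉ Set.range (algebraMap ℤ_[2] ℚ_[2]) ∨
      ∃ u w : ℤ_[2], algebraMap ℤ_[2] ℚ_[2] u = ((x₀ : ℚ) : ℚ_[2]) ∧ algebraMap ℤ_[2] ℚ_[2] w = ((y₀ : ℚ) : ℚ_[2]) ∧
        (W₀.map (IsLocalRing.residue ℤ_[2])).toAffine.Nonsingular (IsLocalRing.residue ℤ_[2] u)
          (IsLocalRing.residue ℤ_[2] w) at hPH
  rcases hPH with hxr | ⟨u, w, hu, hw, hns'⟩
  · exact absurd ⟨(x₀ : ℤ_[2]), by simp⟩ hxr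
  -- `u = x₀`, `w = y₀`
  have hu' : u = (x₀ : ℤ_[2]) := by
    apply IsFractionRing.injective ℤ_[2] ℚ_[2]
    rw [hu]; simp
  have hw' : w = (y₀ : ℤ_[2]) := by
    apply IsFractionRing.injective ℤ_[2] ℚ_[2]
    rw [hw]; simp
  subst hu' hw'
  -- read the nonsingularity on `M mod 2 = M.map φ`, `φ : ℤ → 𝔽₂`
  set φ : ℤ →+* IsLocalRing.ResidueField ℤ_[2] := (IsLocalRing.residue ℤ_[2]).comp (Int.castRingHom ℤ_[2]) with hφ
  have hmapφ : W₀.map (IsLocalRing.residue ℤ_[2]) = M.map φ := by rw [hW₀, WeierstrassCurve.map_map]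
  have hφx : IsLocalRing.residue ℤ_[2] (x₀ : ℤ_[2]) = φ x₀ := by simp [hφ]
  have hφy : IsLocalRing.residue ℤ_[2] (y₀ : ℤ_[2]) = φ y₀ := by simp [hφ]
  have hφ2 : (2 : IsLocalRing.ResidueField ℤ_[2]) = 0 := by
    have h := residue_two_eq_zero
    rwa [map_ofNat] at h
  rw [hmapφ, hφx, hφy, WeierstrassCurve.Affine.nonsingular_iff'] at hns'
  obtain ⟨-, hdisj⟩ := hns'
  simp only [map_a₁, map_a₂, map_a₃, map_a₄] at hdisj
  refine ⟨x₀, y₀, M.a₁ * y₀ - 3 * x₀ ^ 2 - 2 * M.a₂ * x₀ - M.a₄, M.a₁ * x₀ + M.a₃, hE, ?_, ?_, ?_, ?_⟩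
  · rw [ha₁, ha₃]; exact_mod_cast h2yZ
  · rw [ha₁, ha₂, ha₄]; push_cast; ring
  · rw [ha₁, ha₃]; push_cast; ring
  · rintro ⟨⟨k, hk⟩, -⟩
    rcases hdisj with hne | hne
    · apply hne
      have h := congrArg φ hk
      simp only [map_sub, map_mul, map_pow, map_ofNat] at h
      linear_combination h + φ k * hφ2
    · apply hne
      have h := congrArg φ h2yZ
      simp only [map_add, map_mul, map_ofNat, map_zero] at h
      linear_combination h

/-- **At `4 ∥ N` every rational `2`-torsion point lies in `E⁰(ℚ₂)`** — both tame types IV and IV* have `c₂ ∈ {1, 3}`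
(`tamagawaTwoMemOneThreeAtFour_holds`). [cite: SilvermanATAEC1994, IV.9.4 Steps 3–5 and Table 4.1] [cite: SilvermanAEC2009, VII.2 Prop. 2.1] -/
theorem hasTwoTorsionInIdentityComponentAtTwo_of_padicValNat_conductorNorm_eq_two (W : WeierstrassCurve ℚ) [W.IsElliptic]
    [W.IsGloballyMinimal] (h2 : padicValNat 2 (W.conductorNorm ℤ) = 2) (hT : HasRationalTwoTorsion W) :
    HasTwoTorsionInIdentityComponentAtTwo W := by
  have hf := conductorExponent_vTwo_eq_two_of_padicValNat_conductorNorm W h2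
  haveI : PerfectField (IsLocalRing.ResidueField (((primesEquiv (R := 𝓞 ℚ)).symm ⟨2, Nat.prime_two⟩).adicCompletionIntegers ℚ)) :=
    PerfectField.ofFinite
  have hadd : W.HasAdditiveReductionAt ((primesEquiv (R := 𝓞 ℚ)).symm ⟨2, Nat.prime_two⟩) :=
    (W.two_le_conductorExponent_iff_holds ((primesEquiv (R := 𝓞 ℚ)).symm ⟨2, Nat.prime_two⟩)).mp (by rw [hf])
  refine hasTwoTorsionInIdentityComponentAtTwo_of_odd_tamagawaAt W hadd ?_ hT
  rcases tamagawaTwoMemOneThreeAtFour_holds W h2 with h | h <;> rw [h] <;> decide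

/-- **(T2) of `tameConwayKodairaLaw_of_laws`, verbatim, PROVED**: a tame IV* curve (`4 ∥ N`, `v₂(Δ) = 8`) with rational `2`-torsion has a
rational `2`-torsion point in `E⁰(ℚ₂)`. [cite: SilvermanAEC2009, VII.2 Prop. 2.1] [cite: SilvermanATAEC1994, IV.9.4 Table 4.1] -/
theorem tateTwoTorsionIdentityComponent_T2 :
    ∀ (W : WeierstrassCurve ℚ) [W.IsElliptic] [W.IsGloballyMinimal],
      IsTypeFourStarAtTwoTame W → HasRationalTwoTorsion W → HasTwoTorsionInIdentityComponentAtTwo W :=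
  fun W _ _ htame hT ↦ hasTwoTorsionInIdentityComponentAtTwo_of_padicValNat_conductorNorm_eq_two W htame.1 hT

/-- **desc's law reduction with BOTH Tate facts discharged**: E-desc-38 (`TameConwayKodairaLaw`) follows from E-desc-40 (`UnstarredConwayFullLaw`),
E-desc-41 (`StarredConwayDefectLaw`) and E-desc-31 (`ConwayFullOfIdentityComponentTorsion`) — `tameConwayKodairaLaw_of_laws` with (T2) :=
`tateTwoTorsionIdentityComponent_T2`.  (The three laws remain OPEN; nothing about C2 is proved.) -/
theorem tameConwayKodairaLaw_of_laws' (h40 : UnstarredConwayFullLaw) (h41 : StarredConwayDefectLaw)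
    (h31 : ConwayFullOfIdentityComponentTorsion) : TameConwayKodairaLaw :=
  tameConwayKodairaLaw_of_laws tateTwoTorsionIdentityComponent_T2 h40 h41 h31

/-- **desc's E-desc-31 chain from RATIONAL `2`-torsion at `4 ∥ N`**: `not_two_dvd_maninConstant_of_identityComponentTorsion'` (p3 g11,
`…DepthTransfer`) with its `E⁰(ℚ₂)`-torsion hypothesis supplied by `hasTwoTorsionInIdentityComponentAtTwo_of_padicValNat_conductorNorm_eq_two`:
granted the law E-desc-31 (`ConwayFullOfIdentityComponentTorsion`) and the GIVEN row (`IsConwayNeronAtTwo Δ`), a lattice-optimal datum of a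
globally minimal `W` with `4 ∥ N(W)` and `E(ℚ)[2] ≠ 0` has ODD Manin constant.  (Conditional on the law; C2 open.) -/
theorem not_two_dvd_maninConstant_of_hasRationalTwoTorsion_tame
    (hLaw : ConwayFullOfIdentityComponentTorsion)
    (W : WeierstrassCurve ℚ) [W.IsElliptic] [W.IsGloballyMinimal] [NeZero (W.conductorNorm ℤ)]
    (D : ModularParametrizationData W (W.conductorNorm ℤ)) (Δ : NeronFLineDatum W D)
    (hL : ∀ z ∈ D.L.lattice, ∃ w ∈ periodLattice D.f, z = D.c * w)
    (hopt : ∀ (W' : WeierstrassCurve ℚ) [W'.IsElliptic]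
        (D' : ModularParametrizationData W' (W.conductorNorm ℤ)),
        D'.f = D.f → D.modularDegree ≤ D'.modularDegree)
    (h2 : padicValNat 2 (W.conductorNorm ℤ) = 2) (hT : HasRationalTwoTorsion W)
    (hΛ : IsConwayNeronAtTwo Δ)
    (hfin : lineIndex (conwayStableLattice (W.conductorNorm ℤ)) D.f ≠ 0) :
    ¬ (2 : ℤ) ∣ D.maninConstant := by
  have h4 : 4 ∣ W.conductorNorm ℤ := by
    have h := pow_padicValNat_dvd (p := 2) (n := W.conductorNorm ℤ)
    rw [h2] at h; simpa using h
  exact not_two_dvd_maninConstant_of_identityComponentTorsion' hLaw W D Δ hL hopt h4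
    (hasTwoTorsionInIdentityComponentAtTwo_of_padicValNat_conductorNorm_eq_two W h2 hT) hΛ hfin

end Summit.BirchSwinnertonDyer.BirchSwinnertonDyer.Theorems.ManinLocalTwoThree

end
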